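import Summits.NavierStokesRegularity.NavierStokesRegularity.Theorems.ExtremiserTransiencePlateauSliceRigidity
import Summits.NavierStokesRegularity.NavierStokesRegularity.Theorems.ExtremiserTransienceZoomCompactness
import Summits.NavierStokesRegularity.NavierStokesRegularity.Theorems.ExtremiserTransiencePlateauPersistenceSlice
import Summits.NavierStokesRegularity.NavierStokesRegularity.Theorems.ExtremiserTransienceZoomPlateauVolume
import Summits.NavierStokesRegularity.NavierStokesRegularity.Theorems.ExtremiserTransienceZoomTypeI
import Summits.NavierStokesRegularity.NavierStokesRegularity.Theorems.ExtremiserTransiencePerFlowScaleLock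
import HarnessLib

/-!
# Crux `NearExtremalTransiencePerFlow` (stmt-NavierStokesRegularity-26567) — LINE g6-β «regularised transfer»
# (seat ns-idea-5 g6, technique: extremal-example mining): a CHECKED SKELETON through the regularised path of rev 21

Target BY NAME: `Summit.NavierStokesRegularity.NavierStokesRegularity.Theses.ExtremiserTransience.NearExtremalTransiencePerFlow`.
Hypothesis item BY NAME: `RegularisedNearPlateauStability` (28317, crux of LINE g6-α).  Three registered stubs = the content of the
support item `RegularisedSliceTransfer` (28318):
* `stub_higherTypeIRates` (T1, analysis, L–XL Lean): ALL-ORDER Type-I rates `‖Dʲu(t)‖_∞ ≤ C_j·(√ν/√(T−t))·(√(ν(T−t)))^{−j}` with ONE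
  onset for every order (parabolic bootstrap on the window `[t − (T−t)/2, t]`; j = 1 is the landed
  `PerFlow.gradTypeIRate_of_typeIRate`, all orders on mild windows `KNSSBootstrap.exists_norm_iteratedFDeriv_slice_le`);
* `stub_regularNearPlateauSlices` (T2–T3, bookkeeping, M): at the near-efficient TWO-SIDED-LOCKED times of the landed
  `PerFlow.scaleLock_at_nearEfficient_times` (the SAME time is (κ⋆−ε)-efficient AND has `c₁ν(T−t)·P ≤ Z ≤ c₂ν(T−t)·P`; the set is
  non-null for every ε and every onset t₁), Leray's lower rate (`lerayLowerRate_of_not_extends`) and T1 make the slice A-regular at the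
  scale `λ = √(Z/P)` with a PER-FLOW budget `A_j = max 1 (C_j c₂^{j/2}·2C/c₀)`, so the crux (with `c₀(A), r(A)` now fixed along the flow)
  gives, for every δ and arbitrarily late, a slice time t, an envelope-comparable bound M (`c_l√ν ≤ √(T−t)·M ≤ c_h√ν`) and a ball of
  radius `r√(ν(T−t))` in which `{‖u(t)‖ ≥ (1−δ)M}` has volume `≥ c₀ (r√(ν(T−t)))³` (lock constants absorbed into `c₀, r`);
* `stub_plateauZoom` (T4, M math / L Lean): moving-centre zooms at those data with FIXED zoomed plateau time `−s₀` (amplitude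
  `A_n² = s₀ν/(θ(T−t_n))`, centre time `t_n + θ(T−t_n)`), the landed `volume_zoom_nearPlateau_ge`, `zoom_typeI_bound`,
  `zoomCompactnessKNSS` (S2) and `plateauPersistenceSlice` (S3) give the weak-class ancient slice object with an exact positive-volume
  plateau (`m₀ ≥ c_l√(θ/s₀) > 0`, radius `≤ r√(s₀/θ)`, volume `≥ c₀ r³ (s₀/θ)^{3/2}`).
Composition `NearExtremalTransiencePerFlow_of` (kernel-checked, no sorry outside the stubs): the object is excluded by the landed
`plateauSliceRigidity` (27823), so the per-flow certificate exists.  HONEST FRAMING: implications between OPEN statements about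
hypothetical Type-I singular flows; nothing about Navier–Stokes regularity or blow-up is proved here; no summit is proved by a line.
-/

open scoped Topology InnerProductSpace
open MeasureTheory Filter
open Summit.NavierStokesRegularity.NavierStokesRegularity.Theses.ExtremiserTransience

namespace Summit.NavierStokesRegularity.NavierStokesRegularity.Cruxes.NearExtremalTransiencePerFlow.RegularisedTransfer

set_option linter.dupNamespace false

/-! ## §1 Stub statements as `Prop`s (one `def` per registered stub) -/

/-- Statement of T1 (`stub_higherTypeIRates`): all-order Type-I rates with one onset. -/
def HigherTypeIRates : Prop := ∀ (C ν T : ℝ), 0 < C → 0 < ν → 0 < T → ∀ (u : ℝ → EuclideanSpace ℝ (Fin 3) → EuclideanSpace ℝ (Fin 3)) (p : ℝ → EuclideanSpace ℝ (Fin 3) → ℝ), Literature.Analysis.FluidPDE.IsClassicalNSSolutionOn (Set.Ico 0 T) ν 0 u p → Literature.Analysis.FluidPDE.IsLerayHopfOn T ν 0 (u 0) u → Literature.Analysis.FluidPDE.HasRapidSpatialDecay (u 0) → (∀ᶠ t in 𝓝[<] T, ∀ x, Real.sqrt (T - t) * ‖u t x‖ ≤ C * Real.sqrt ν) → (∃ Cs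 : ℕ → ℝ, ∀ᶠ t in 𝓝[<] T, ∀ (j : ℕ) (x : EuclideanSpace ℝ (Fin 3)), ‖iteratedFDeriv ℝ j (u t) x‖ ≤ Cs j * (Real.sqrt ν / Real.sqrt (T - t)) * (Real.sqrt (ν * (T - t)))⁻¹ ^ j)

/-- Statement of T2–T3 (`stub_regularNearPlateauSlices`): the crux 28317 applied at near-efficient two-sided-locked regular
times, arbitrarily late, for every δ (lock and Leray constants absorbed; envelope-comparable M). -/
def RegularNearPlateauSlices : Prop := Summit.NavierStokesRegularity.NavierStokesRegularity.Theses.ExtremiserTransience.RegularisedNearPlateauStability → ∀ (C ν T : ℝ), 0 < C → 0 < ν → 0 < T → ∀ (u : ℝ → EuclideanSpace ℝ (Fin 3) → EuclideanSpace ℝ (Fin 3)) (p : ℝ → EuclideanSpace ℝ (Fin 3) → ℝ), Literature.Analysis.FluidPDE.IsClassicalNSSolutionOn (Set.Ico 0 T) ν 0 u p → Literature.Analysis.FluidPDE.IsLerayHopfOn T ν 0 (u 0) u → Literature.Analysis.FluidPDE.HasRapidSpatialDecay (u 0) → (∀ᶠ t in 𝓝[<] T, ∀ x, Real.sqrt (T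 - t) * ‖u t x‖ ≤ C * Real.sqrt ν) → ¬ Literature.Analysis.FluidPDE.HasSmoothExtensionPast ν 0 u T → ¬ (∃ θ : ℝ, 0 ≤ θ ∧ θ < 1 ∧ ∀ κ : ℝ, (∀ (v : EuclideanSpace ℝ (Fin 3) → EuclideanSpace ℝ (Fin 3)) (M B : ℝ), ContDiff ℝ (⊤ : ℕ∞) v → Literature.Analysis.FluidPDE.VectorCalculus.IsDivFree v → (∀ x, ‖v x‖ ≤ M) → (∀ x, ‖fderiv ℝ v x‖ ≤ B) → (∫⁻ x, ‖iteratedFDeriv ℝ 0 v x‖ₑ ^ 2 < ⊤) → (∫⁻ x, ‖iteratedFDeriv ℝ 1 v x‖ₑ ^ 2 < ⊤) → (∫⁻ x, ‖iteratedFDeriv ℝ 2 v x‖ₑ ^ 2 < ⊤) → |∫ x, ⟪Literature.Analysis.FluidPDE.curl v x, fderiv ℝ v x (Literature.Analysis.FluidPDE.curl v x)⟫_ℝ| ≤ κ * M * Real.sqrt (∫ x, ‖Literature.Analysis.FluidPDE.curl v x‖ ^ 2) * Real.sqrt (∫ x, Literature.Analysis.FluidPDE.frobeniusNormSq (fderiv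 ℝ (Literature.Analysis.FluidPDE.curl v) x))) → ∃ t₁ ∈ Set.Ico 0 T, ∃ (k : ℝ → ℝ) (B : ℝ), Measurable k ∧ (∀ τ, 0 ≤ k τ ∧ k τ ≤ 1) ∧ (∀ t ∈ Set.Ico t₁ T, ∀ M : ℝ, (∀ x, ‖u t x‖ ≤ M) → |∫ x, ⟪Literature.Analysis.FluidPDE.curl (u t) x, fderiv ℝ (u t) x (Literature.Analysis.FluidPDE.curl (u t) x)⟫_ℝ| ≤ k t * M * Real.sqrt (∫ x, ‖Literature.Analysis.FluidPDE.curl (u t) x‖ ^ 2) * Real.sqrt (∫ x, Literature.Analysis.FluidPDE.frobeniusNormSq (fderiv ℝ (Literature.Analysis.FluidPDE.curl (u t)) x))) ∧ (∀ t ∈ Set.Ico t₁ T, ∫ τ in t₁..t, k τ ^ 2 / (T - τ) ≤ (θ * κ) ^ 2 * Real.log ((T - t₁) / (T - t)) + B)) → (∃ Cs : ℕ → ℝ, ∀ᶠ t in 𝓝[<] T, ∀ (j : ℕ) (x : EuclideanSpace ℝ (Fin 3)), ‖iteratedFDeriv ℝ j (u t) x‖ ≤ Cs j * (Real.sqrt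 ν / Real.sqrt (T - t)) * (Real.sqrt (ν * (T - t)))⁻¹ ^ j) → (∃ c₀ r cl ch : ℝ, 0 < c₀ ∧ 0 < r ∧ 0 < cl ∧ cl ≤ ch ∧ ∀ δ : ℝ, 0 < δ → ∀ t₁ ∈ Set.Ico 0 T, ∃ t ∈ Set.Ico t₁ T, ∃ (M : ℝ) (x₀ : EuclideanSpace ℝ (Fin 3)), (∀ x, ‖u t x‖ ≤ M) ∧ cl * Real.sqrt ν ≤ Real.sqrt (T - t) * M ∧ Real.sqrt (T - t) * M ≤ ch * Real.sqrt ν ∧ ENNReal.ofReal (c₀ * (r * Real.sqrt (ν * (T - t))) ^ 3) ≤ MeasureTheory.volume {x : EuclideanSpace ℝ (Fin 3) | x ∈ Metric.ball x₀ (r * Real.sqrt (ν * (T - t))) ∧ (1 - δ) * M ≤ ‖u t x‖})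

/-- Statement of T4 (`stub_plateauZoom`): moving-centre zooms with fixed zoomed plateau time produce the weak-class one-slice
object with an exact positive-volume speed plateau. -/
def PlateauZoom : Prop := ∀ (C ν T : ℝ), 0 < C → 0 < ν → 0 < T → ∀ (u : ℝ → EuclideanSpace ℝ (Fin 3) → EuclideanSpace ℝ (Fin 3)) (p : ℝ → EuclideanSpace ℝ (Fin 3) → ℝ), Literature.Analysis.FluidPDE.IsClassicalNSSolutionOn (Set.Ico 0 T) ν 0 u p → Literature.Analysis.FluidPDE.IsLerayHopfOn T ν 0 (u 0) u → Literature.Analysis.FluidPDE.HasRapidSpatialDecay (u 0) → (∀ᶠ t in 𝓝[<] T, ∀ x, Real.sqrt (T - t) * ‖u t x‖ ≤ C * Real.sqrt ν) → (∃ c₀ r cl ch : ℝ, 0 < c₀ ∧ 0 < r ∧ 0 < cl ∧ cl ≤ ch ∧ ∀ δ : ℝ, 0 < δ → ∀ t₁ ∈ Set.Ico 0 T, ∃ t ∈ Set.Ico t₁ T, ∃ (M : ℝ) (x₀ : EuclideanSpace ℝ (Fin 3)), (∀ x, ‖u t x‖ ≤ M) ∧ cl * Real.sqrt ν ≤ Real.sqrt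 (T - t) * M ∧ Real.sqrt (T - t) * M ≤ ch * Real.sqrt ν ∧ ENNReal.ofReal (c₀ * (r * Real.sqrt (ν * (T - t))) ^ 3) ≤ MeasureTheory.volume {x : EuclideanSpace ℝ (Fin 3) | x ∈ Metric.ball x₀ (r * Real.sqrt (ν * (T - t))) ∧ (1 - δ) * M ≤ ‖u t x‖}) → ∃ (W : ℝ → EuclideanSpace ℝ (Fin 3) → EuclideanSpace ℝ (Fin 3)) (K t₀ m : ℝ), ContinuousOn (Function.uncurry W) (Set.Iio (0 : ℝ) ×ˢ Set.univ) ∧ (∀ s t : ℝ, s < t → t < 0 → ∀ x, W t x = Literature.Analysis.FluidPDE.heatFlow (W s) (t - s) x - Literature.Analysis.FluidPDE.oseenDuhamel 1 s W W t x) ∧ (∀ t : ℝ, t < 0 → ∀ x, Real.sqrt (-t) * ‖W t x‖ ≤ K) ∧ t₀ < 0 ∧ 0 < m ∧ (∀ y, ‖W t₀ y‖ ≤ m) ∧ 0 < MeasureTheory.volume {y : EuclideanSpace ℝ (Fin 3) | ‖W t₀ y‖ = m}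

/-! ## §2 Registered stubs (the only `sorry`s of the file; statements = §1 unfolded one level) -/

/-- T1 — ALL-ORDER TYPE-I RATES with one onset (parabolic bootstrap under the Type-I envelope; j = 1 is the landed
`PerFlow.gradTypeIRate_of_typeIRate`, all orders on mild windows `KNSSBootstrap.exists_norm_iteratedFDeriv_slice_le`). [folklore] -/
theorem stub_higherTypeIRates : ∀ (C ν T : ℝ), 0 < C → 0 < ν → 0 < T → ∀ (u : ℝ → EuclideanSpace ℝ (Fin 3) → EuclideanSpace ℝ (Fin 3)) (p : ℝ → EuclideanSpace ℝ (Fin 3) → ℝ), Literature.Analysis.FluidPDE.IsClassicalNSSolutionOn (Set.Ico 0 T) ν 0 u p → Literature.Analysis.FluidPDE.IsLerayHopfOn T ν 0 (u 0) u → Literature.Analysis.FluidPDE.HasRapidSpatialDecay (u 0) → (∀ᶠ t in 𝓝[<] T, ∀ x, Real.sqrt (T - t) * ‖u t x‖ ≤ C * Real.sqrt ν) → (∃ Cs : ℕ → ℝ, ∀ᶠ t in 𝓝[<] T, ∀ (j : ℕ) (x : EuclideanSpace ℝ (Fin 3)), ‖iteratedFDeriv ℝ j (u t) x‖ ≤ Cs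 j * (Real.sqrt ν / Real.sqrt (T - t)) * (Real.sqrt (ν * (T - t)))⁻¹ ^ j) := by
  sorry

/-- T2–T3 — REGULAR NEAR-PLATEAU SLICES (bookkeeping over the landed `PerFlow.scaleLock_at_nearEfficient_times`,
`PerFlow.lerayLowerRate_of_not_extends` and T1; the crux 28317 is the first hypothesis, BY NAME). [folklore] -/
theorem stub_regularNearPlateauSlices : Summit.NavierStokesRegularity.NavierStokesRegularity.Theses.ExtremiserTransience.RegularisedNearPlateauStability → ∀ (C ν T : ℝ), 0 < C → 0 < ν → 0 < T → ∀ (u : ℝ → EuclideanSpace ℝ (Fin 3) → EuclideanSpace ℝ (Fin 3)) (p : ℝ → EuclideanSpace ℝ (Fin 3) → ℝ), Literature.Analysis.FluidPDE.IsClassicalNSSolutionOn (Set.Ico 0 T) ν 0 u p → Literature.Analysis.FluidPDE.IsLerayHopfOn T ν 0 (u 0) u → Literature.Analysis.FluidPDE.HasRapidSpatialDecay (u 0) → (∀ᶠ t in 𝓝[<] T, ∀ x, Real.sqrt (T - t) * ‖u t x‖ ≤ C * Real.sqrt ν) → ¬ Literature.Analysis.FluidPDE.HasSmoothExtensionPast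 ν 0 u T → ¬ (∃ θ : ℝ, 0 ≤ θ ∧ θ < 1 ∧ ∀ κ : ℝ, (∀ (v : EuclideanSpace ℝ (Fin 3) → EuclideanSpace ℝ (Fin 3)) (M B : ℝ), ContDiff ℝ (⊤ : ℕ∞) v → Literature.Analysis.FluidPDE.VectorCalculus.IsDivFree v → (∀ x, ‖v x‖ ≤ M) → (∀ x, ‖fderiv ℝ v x‖ ≤ B) → (∫⁻ x, ‖iteratedFDeriv ℝ 0 v x‖ₑ ^ 2 < ⊤) → (∫⁻ x, ‖iteratedFDeriv ℝ 1 v x‖ₑ ^ 2 < ⊤) → (∫⁻ x, ‖iteratedFDeriv ℝ 2 v x‖ₑ ^ 2 < ⊤) → |∫ x, ⟪Literature.Analysis.FluidPDE.curl v x, fderiv ℝ v x (Literature.Analysis.FluidPDE.curl v x)⟫_ℝ| ≤ κ * M * Real.sqrt (∫ x, ‖Literature.Analysis.FluidPDE.curl v x‖ ^ 2) * Real.sqrt (∫ x, Literature.Analysis.FluidPDE.frobeniusNormSq (fderiv ℝ (Literature.Analysis.FluidPDE.curl v) x))) → ∃ t₁ ∈ Set.Ico 0 T, ∃ (k : ℝ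 → ℝ) (B : ℝ), Measurable k ∧ (∀ τ, 0 ≤ k τ ∧ k τ ≤ 1) ∧ (∀ t ∈ Set.Ico t₁ T, ∀ M : ℝ, (∀ x, ‖u t x‖ ≤ M) → |∫ x, ⟪Literature.Analysis.FluidPDE.curl (u t) x, fderiv ℝ (u t) x (Literature.Analysis.FluidPDE.curl (u t) x)⟫_ℝ| ≤ k t * M * Real.sqrt (∫ x, ‖Literature.Analysis.FluidPDE.curl (u t) x‖ ^ 2) * Real.sqrt (∫ x, Literature.Analysis.FluidPDE.frobeniusNormSq (fderiv ℝ (Literature.Analysis.FluidPDE.curl (u t)) x))) ∧ (∀ t ∈ Set.Ico t₁ T, ∫ τ in t₁..t, k τ ^ 2 / (T - τ) ≤ (θ * κ) ^ 2 * Real.log ((T - t₁) / (T - t)) + B)) → (∃ Cs : ℕ → ℝ, ∀ᶠ t in 𝓝[<] T, ∀ (j : ℕ) (x : EuclideanSpace ℝ (Fin 3)), ‖iteratedFDeriv ℝ j (u t) x‖ ≤ Cs j * (Real.sqrt ν / Real.sqrt (T - t)) * (Real.sqrt (ν * (T - t)))⁻¹ ^ j) → (∃ c₀ r cl ch : ℝ,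 0 < c₀ ∧ 0 < r ∧ 0 < cl ∧ cl ≤ ch ∧ ∀ δ : ℝ, 0 < δ → ∀ t₁ ∈ Set.Ico 0 T, ∃ t ∈ Set.Ico t₁ T, ∃ (M : ℝ) (x₀ : EuclideanSpace ℝ (Fin 3)), (∀ x, ‖u t x‖ ≤ M) ∧ cl * Real.sqrt ν ≤ Real.sqrt (T - t) * M ∧ Real.sqrt (T - t) * M ≤ ch * Real.sqrt ν ∧ ENNReal.ofReal (c₀ * (r * Real.sqrt (ν * (T - t))) ^ 3) ≤ MeasureTheory.volume {x : EuclideanSpace ℝ (Fin 3) | x ∈ Metric.ball x₀ (r * Real.sqrt (ν * (T - t))) ∧ (1 - δ) * M ≤ ‖u t x‖}) := by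
  sorry

/-- T4 — PLATEAU ZOOM (landed S2 `zoomCompactnessKNSS`, S3 `plateauPersistenceSlice`, `volume_zoom_nearPlateau_ge`,
`zoom_typeI_bound`; amplitude normalised so the plateau slice sits at a fixed zoomed time). [folklore] -/
theorem stub_plateauZoom : ∀ (C ν T : ℝ), 0 < C → 0 < ν → 0 < T → ∀ (u : ℝ → EuclideanSpace ℝ (Fin 3) → EuclideanSpace ℝ (Fin 3)) (p : ℝ → EuclideanSpace ℝ (Fin 3) → ℝ), Literature.Analysis.FluidPDE.IsClassicalNSSolutionOn (Set.Ico 0 T) ν 0 u p → Literature.Analysis.FluidPDE.IsLerayHopfOn T ν 0 (u 0) u → Literature.Analysis.FluidPDE.HasRapidSpatialDecay (u 0) → (∀ᶠ t in 𝓝[<] T, ∀ x, Real.sqrt (T - t) * ‖u t x‖ ≤ C * Real.sqrt ν) → (∃ c₀ r cl ch : ℝ, 0 < c₀ ∧ 0 < r ∧ 0 < cl ∧ cl ≤ ch ∧ ∀ δ : ℝ, 0 < δ → ∀ t₁ ∈ Set.Ico 0 T, ∃ t ∈ Set.Ico t₁ T, ∃ (M : ℝ) (x₀ : EuclideanSpace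 ℝ (Fin 3)), (∀ x, ‖u t x‖ ≤ M) ∧ cl * Real.sqrt ν ≤ Real.sqrt (T - t) * M ∧ Real.sqrt (T - t) * M ≤ ch * Real.sqrt ν ∧ ENNReal.ofReal (c₀ * (r * Real.sqrt (ν * (T - t))) ^ 3) ≤ MeasureTheory.volume {x : EuclideanSpace ℝ (Fin 3) | x ∈ Metric.ball x₀ (r * Real.sqrt (ν * (T - t))) ∧ (1 - δ) * M ≤ ‖u t x‖}) → ∃ (W : ℝ → EuclideanSpace ℝ (Fin 3) → EuclideanSpace ℝ (Fin 3)) (K t₀ m : ℝ), ContinuousOn (Function.uncurry W) (Set.Iio (0 : ℝ) ×ˢ Set.univ) ∧ (∀ s t : ℝ, s < t → t < 0 → ∀ x, W t x = Literature.Analysis.FluidPDE.heatFlow (W s) (t - s) x - Literature.Analysis.FluidPDE.oseenDuhamel 1 s W W t x) ∧ (∀ t : ℝ, t < 0 → ∀ x, Real.sqrt (-t) * ‖W t x‖ ≤ K) ∧ t₀ < 0 ∧ 0 < m ∧ (∀ y, ‖W t₀ y‖ ≤ m) ∧ 0 < MeasureTheory.volume {y : EuclideanSpace ℝ (Fin 3)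 | ‖W t₀ y‖ = m} := by
  sorry

/-! ### Registered-stub aliases: `Registered.stub_X` is stub `X`'s statement under the registered stub's short name, so that the
native skeleton audit (`#h21_check_skeleton … stub_…`, run by `ledger skeleton check`) accepts the hypotheses of
`NearExtremalTransiencePerFlow_of` as registered obligations (hypothesis heads are matched by name). -/
namespace Registered

/-- Statement of registered stub T1. -/
abbrev stub_higherTypeIRates : Prop := HigherTypeIRates
/-- Statement of registered stub T2–T3. -/
abbrev stub_regularNearPlateauSlices : Prop := RegularNearPlateauSlices
/-- Statement of registered stub T4. -/
abbrev stub_plateauZoom : Prop := PlateauZoom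

end Registered

/-! ## §3 Composition (real proofs, no `sorry` below this line) -/

/-- The three stubs prove the support item `RegularisedSliceTransfer` (28318) of the rev-21 split. -/
theorem RegularisedSliceTransfer_of
    (h1 : Registered.stub_higherTypeIRates) (h2 : Registered.stub_regularNearPlateauSlices) (h3 : Registered.stub_plateauZoom) :
    Summit.NavierStokesRegularity.NavierStokesRegularity.Theses.ExtremiserTransience.RegularisedSliceTransfer := by
  have h1' : HigherTypeIRates := h1
  have h2' : RegularNearPlateauSlices := h2
  have h3' : PlateauZoom := h3
  intro hC C ν T hC0 hν hT u p hsol hLH hdec hrate hne hno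
  exact h3' C ν T hC0 hν hT u p hsol hLH hdec hrate
    (h2' hC C ν T hC0 hν hT u p hsol hLH hdec hrate hne hno (h1' C ν T hC0 hν hT u p hsol hLH hdec hrate))

/-- **COMPOSITION (the skeleton theorem, kernel-checked).** T1 → T2–T3 → T4 → `RegularisedNearPlateauStability` (route item
28317, BY NAME) → the crux `NearExtremalTransiencePerFlow` BY NAME: by contradiction, the weak-class slice object produced by the
stubs is excluded by the landed `plateauSliceRigidity` (27823), so the per-flow certificate exists. -/
theorem NearExtremalTransiencePerFlow_of
    (h1 : Registered.stub_higherTypeIRates) (h2 : Registered.stub_regularNearPlateauSlices) (h3 : Registered.stub_plateauZoom)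
    (hC : Summit.NavierStokesRegularity.NavierStokesRegularity.Theses.ExtremiserTransience.RegularisedNearPlateauStability) :
    Summit.NavierStokesRegularity.NavierStokesRegularity.Theses.ExtremiserTransience.NearExtremalTransiencePerFlow := by
  intro C ν T hC0 hν hT u p hsol hLH hdec hrate hne
  by_contra hno
  exact plateauSliceRigidity (RegularisedSliceTransfer_of h1 h2 h3 hC C ν T hC0 hν hT u p hsol hLH hdec hrate hne hno)

/-- How the closed proof is obtained once the three stubs land (an `example`, so that `NearExtremalTransiencePerFlow_of` is the
only theorem of this file concluding the crux; it also checks that each registered stub's statement is definitionally its §1 `def`). -/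
example (hC : Summit.NavierStokesRegularity.NavierStokesRegularity.Theses.ExtremiserTransience.RegularisedNearPlateauStability) :
    Summit.NavierStokesRegularity.NavierStokesRegularity.Theses.ExtremiserTransience.NearExtremalTransiencePerFlow :=
  NearExtremalTransiencePerFlow_of stub_higherTypeIRates stub_regularNearPlateauSlices stub_plateauZoom hC

end Summit.NavierStokesRegularity.NavierStokesRegularity.Cruxes.NearExtremalTransiencePerFlow.RegularisedTransfer
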